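import Summits.HubbardSuperconductivity.HubbardSuperconductivity.Theses.FunctionFieldCertificate
import Summits.HubbardSuperconductivity.HubbardSuperconductivity.Theorems.FunctionFieldCertificateWindowInfraredBoundReductions
import Summits.HubbardSuperconductivity.HubbardSuperconductivity.Theorems.FunctionFieldCertificateWindowInfraredBoundInfraredLeak
import HarnessLib.Audit.CruxProbe

/-! BC2/BC7-style probe of the crux `WindowInfraredBound` (stmt-HubbardSuperconductivity-1089) against the summit:
P5 `C → S` (summit strength) and `S → C` (informational), plus the tautology / vacuity / rigidity batteries. -/

set_option h21.cruxProbe.batteryMs 90000 in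
#h21_crux_probe Summit.HubbardSuperconductivity.HubbardSuperconductivity.Theses.FunctionFieldCertificate.WindowInfraredBound route := "route-HubbardSuperconductivity-FunctionFieldCertificate"
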